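import Literature.Analysis.FluidPDE.NovackMatrixKernel
import HarnessLib

/-!
# Novack's pressure step for matrix kernels: discharge of the space–time pressure split

Topic: Analysis/FluidPDE, proofs companion to `Literature.Analysis.FluidPDE.NovackMatrixKernel`.

The space–time form of the pressure step, `Torus.integral_pressure_divergence_matSymmTestField`
(Novack 2024, §2 Step 2, first display and the pressure terms of (last:one:L)): for a jointly
measurable `u ∈ L³((0,T) × T^d)` weakly divergence free at a.e. time, `p ∈ L^{3/2}((0,T) × T^d)`,
a smooth matrix kernel `M` with a smooth even potential `ζ` (`∑ᵢ ∂ᵢ(M i j) = ∂ⱼ ζ`) and a test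
function `ψ` supported in `(0,T)`,
`∫₀ᵀ∫ p div Φ_M = ∫₀ᵀ∫ p ⟪u_M, ∇ψ⟫ + ∫₀ᵀ∫ (p ⋆ ζ) ⟪u, ∇ψ⟫`, `Φ_M = ψ u_M + (ψ u)_M`.

## Proof

At a.e. time the slice `u(t)` is integrable and weakly divergence free, so the proved slice
identity `Torus.divergence_matSymmTestField` gives, a.e. on `(0,T) × T^d`,
`p div Φ_M = ∑ᵢⱼ (p ∂ᵢψ)(uⱼ ⋆ M i j) + p (⟪u,∇ψ⟫ ⋆ ζ)`. The weights `p ∂ᵢψ`, `p` are in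
`L^{3/2}` and the mollified fields `uⱼ ⋆ M i j`, `⟪u,∇ψ⟫ ⋆ ζ` in `L³` of the product (Young's
inequality with the `L¹` norm of the continuous kernel, slice-wise, and Tonelli:
`lintegral_prod_rpow_enorm_convolution_le_mul`), so every product is integrable on
`(0,T) × T^d` (Hölder `3/2, 3`, the accepted `Torus.integrable_mul_of_lintegral_rpow`); Fubini turns
the product integrals into the iterated ones, and at a.e. time the adjointness of mollification
by the even kernel `ζ` (`Torus.integral_mul_convolution_comm`) moves `ζ` onto `p`.

## References

* M. Novack, *Scaling laws and exact results in turbulence*, Nonlinearity 37 (2024) 095002,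
  arXiv:2310.01375, §2 Step 2 (potentials `ζ̃`, (last:one:L)). [Novack2024]
* L. Grafakos, *Classical Fourier Analysis*, Thm. 1.2.10 (Young's inequality). [folklore]
-/

noncomputable section

open MeasureTheory TopologicalSpace Set Function Filter Metric
open _root_.Topology
open scoped ENNReal NNReal Convolution ContDiff InnerProductSpace RealInnerProductSpace

namespace Literature.Analysis.FluidPDE.Torus

variable {d : Type*} [Fintype d] [DecidableEq d]

/-! ## Young's inequality with a signed continuous kernel, `L^r`-integral and space–time forms -/

section Young

omit [DecidableEq d] in
/-- **Young's inequality, `L^r` integral form, signed kernel**: for a.e.-strongly measurable `θ`,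
a continuous kernel `k` on `T^d` and `r ≥ 1`, `∫ |θ ⋆ k|^r ≤ (∫ |k|)^r ∫ |θ|^r`
(`Torus.eLpNorm_convolution_le`). [folklore] -/
theorem lintegral_rpow_enorm_convolution_le_mul {θ : UnitAddTorus d → ℝ}
    (hθ : AEStronglyMeasurable θ volume) {k : UnitAddTorus d → ℝ} (hk : Continuous k) {r : ℝ}
    (hr : 1 ≤ r) :
    ∫⁻ x, ‖(θ ⋆ k) x‖ₑ ^ r ≤ (∫⁻ y, ‖k y‖ₑ) ^ r * ∫⁻ x, ‖θ x‖ₑ ^ r := by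
  have hr0 : 0 < r := one_pos.trans_le hr
  set p : ℝ≥0∞ := ENNReal.ofReal r with hp
  have hp1 : 1 ≤ p := by
    rw [hp, ← ENNReal.ofReal_one]
    exact ENNReal.ofReal_le_ofReal hr
  have hp0 : p ≠ 0 := (zero_lt_one.trans_le hp1).ne'
  have hpt : p ≠ ⊤ := ENNReal.ofReal_ne_top
  have hpr : p.toReal = r := ENNReal.toReal_ofReal hr0.le
  have h := FunctionSpaces.Torus.eLpNorm_convolution_le hθ hk.aestronglyMeasurable hp1
  rw [eLpNorm_eq_lintegral_rpow_enorm_toReal hp0 hpt,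
    eLpNorm_eq_lintegral_rpow_enorm_toReal hp0 hpt, hpr] at h
  have h' := ENNReal.rpow_le_rpow h hr0.le
  rwa [one_div, ENNReal.rpow_inv_rpow hr0.ne', ENNReal.mul_rpow_of_nonneg _ _ hr0.le,
    ENNReal.rpow_inv_rpow hr0.ne'] at h'

variable {α : Type*} [MeasurableSpace α] {μ : Measure α} [SFinite μ]

omit [DecidableEq d] in
/-- **Space–time Young inequality, signed kernel**: for a jointly measurable `θ : α × T^d → ℝ`, a
continuous kernel `k` and `r ≥ 1`, `∫∫ |θ(a) ⋆ k|^r ≤ (∫ |k|)^r ∫∫ |θ|^r` (Tonelli and the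
slice-wise inequality). [folklore] -/
theorem lintegral_prod_rpow_enorm_convolution_le_mul {θ : α → UnitAddTorus d → ℝ}
    (hm : AEStronglyMeasurable (uncurry θ) (μ.prod volume)) {k : UnitAddTorus d → ℝ}
    (hk : Continuous k) {r : ℝ} (hr : 1 ≤ r) :
    ∫⁻ z, ‖(θ z.1 ⋆ k) z.2‖ₑ ^ r ∂(μ.prod volume) ≤
      (∫⁻ y, ‖k y‖ₑ) ^ r * ∫⁻ z, ‖θ z.1 z.2‖ₑ ^ r ∂(μ.prod volume) := by
  have hmc : AEStronglyMeasurable (uncurry fun a x => (θ a ⋆ k) x) (μ.prod volume) :=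
    FunctionSpaces.Torus.aestronglyMeasurable_uncurry_convolution (ContinuousLinearMap.lsmul ℝ ℝ) hm hk
  have e1 : ∫⁻ z, ‖(θ z.1 ⋆ k) z.2‖ₑ ^ r ∂(μ.prod volume) =
      ∫⁻ a, ∫⁻ x, ‖(θ a ⋆ k) x‖ₑ ^ r ∂volume ∂μ :=
    lintegral_prod _ (hmc.enorm.pow_const r)
  have e2 : ∫⁻ z, ‖θ z.1 z.2‖ₑ ^ r ∂(μ.prod volume) = ∫⁻ a, ∫⁻ x, ‖θ a x‖ₑ ^ r ∂volume ∂μ :=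
    lintegral_prod _ (hm.enorm.pow_const r)
  rw [e1, e2, ← lintegral_const_mul' _ _ (ENNReal.rpow_ne_top_of_nonneg (zero_le_one.trans hr)
    (hk.integrable_unitAddTorus).2.ne)]
  refine lintegral_mono_ae ?_
  filter_upwards [hm.prodMk_left] with a ha
  have ha' : AEStronglyMeasurable (θ a) volume := ha
  exact lintegral_rpow_enorm_convolution_le_mul ha' hk hr

end Young

/-! ## Discharge of `integral_pressure_divergence_matSymmTestField` -/

section Pressure

/-- **The pressure pairing of Novack's symmetric matrix field, space–time form** (Novack 2024,
§2 Step 2: by the first display of Step 2, `∂ᵢ(T^{ik}_• φ) = ∂ₖ ζ̃_•` "are gradients of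
potentials. Using this to simplify and adding together (eq:1) and (eq:2)", the pressure terms of
(last:one:L) read `−∂ᵢφ (u^i_{•,ℓ,γ} p + uⁱ p_{ℓ,γ,•})` with `p_{ℓ,γ,•} = p ⋆ ζ̃`). For a jointly
measurable `u ∈ L³((0,T) × T^d)` weakly divergence free for a.e. `t`, `p ∈ L^{3/2}((0,T) × T^d)`,
a smooth matrix kernel `M` with a smooth even potential `ζ` (`∑ᵢ ∂ᵢ(M i j) = ∂ⱼ ζ`), and a test
function `ψ` supported in `(0,T)`, the pressure pairing of `Φ_M = ψ u_M + (ψ u)_M` splits as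
`∫₀ᵀ∫ p div Φ_M = ∫₀ᵀ∫ p ⟪u_M, ∇ψ⟫ + ∫₀ᵀ∫ (p ⋆ ζ) ⟪u, ∇ψ⟫` (proof in the module docstring). [cite: Novack2024, Sect. 2 Step 2 (last:one:L)] -/
theorem integral_pressure_divergence_matSymmTestField {T : ℝ}
    {u : ℝ → UnitAddTorus d → EuclideanSpace ℝ d} {p : ℝ → UnitAddTorus d → ℝ}
    (hmeas : AEStronglyMeasurable (FunctionSpaces.Torus.stLift u) (volume.restrict (Ioo 0 T ×ˢ univ)))
    (hu3 : ∫⁻ t in Ioo 0 T, ∫⁻ x, ‖u t x‖ₑ ^ 3 < ⊤)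
    (hdiv : ∀ᵐ t ∂(volume.restrict (Ioo 0 T)), FunctionSpaces.Torus.IsWeaklyDivFree (u t))
    (hpmeas : AEStronglyMeasurable (FunctionSpaces.Torus.stLift p) (volume.restrict (Ioo 0 T ×ˢ univ)))
    (hp : ∫⁻ t in Ioo 0 T, ∫⁻ x, ‖p t x‖ₑ ^ (3 / 2 : ℝ) < ⊤)
    {M : d → d → UnitAddTorus d → ℝ} (hM : ∀ i j, FunctionSpaces.Torus.IsSmooth (M i j))
    {ζ : UnitAddTorus d → ℝ} (hζ : FunctionSpaces.Torus.IsSmooth ζ) (hζev : ∀ z, ζ (-z) = ζ z)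
    (hpot : ∀ j x, ∑ i, FunctionSpaces.Torus.partialDeriv i (M i j) x =
      FunctionSpaces.Torus.partialDeriv j ζ x)
    {ψ : ℝ → UnitAddTorus d → ℝ} (hψ : FunctionSpaces.Torus.IsSpaceTimeTestIoo T ψ) :
    ∫ t in Ioo 0 T, ∫ x,
        p t x * FunctionSpaces.Torus.divergence (matSymmTestField M (ψ t) (u t)) x =
      (∫ t in Ioo 0 T, ∫ x,
          p t x * ⟪matConv (u t) M x, FunctionSpaces.Torus.gradient (ψ t) x⟫) +
        ∫ t in Ioo 0 T, ∫ x, (p t ⋆ ζ) x * ⟪u t x, FunctionSpaces.Torus.gradient (ψ t) x⟫ := by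
  set μT := (volume.restrict (Ioo 0 T)).prod (volume : Measure (UnitAddTorus d)) with hμT
  -- measurability in product form
  have hum : AEStronglyMeasurable (uncurry u) μT := aestronglyMeasurable_uncurry_prod hmeas
  have hpm : AEStronglyMeasurable (uncurry p) μT := aestronglyMeasurable_uncurry_prod hpmeas
  -- the test field: smooth slices, bounded measurable gradient
  have hψs : ∀ t, FunctionSpaces.Torus.IsSmooth (ψ t) := fun t => hψ.isSpaceTimeTest.isSmooth_slice t
  obtain ⟨-, -, hgr, -⟩ := hψ.isSpaceTimeTest.isSmoothSpaceTimeOn_derived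
  obtain ⟨⟨C, hC0, hC⟩, hgrm⟩ := hgr.bound_and_measurable T
  have hIoo : ∀ᵐ z ∂μT, z.1 ∈ Ioo 0 T := by
    rw [hμT, ← volume_restrict_Ioo_prod_univ]
    filter_upwards [ae_restrict_mem (measurableSet_Ioo.prod MeasurableSet.univ)] with z hz
    exact hz.1
  have hgrb : ∀ᵐ z ∂μT, ‖FunctionSpaces.Torus.gradient (ψ z.1) z.2‖ ≤ C :=
    hIoo.mono fun z hz => hC z.1 (Ioo_subset_Icc_self hz) z.2
  -- finiteness in product form
  have hU3 : ∫⁻ z, ‖u z.1 z.2‖ₑ ^ (3 : ℝ) ∂μT < ⊤ := by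
    have e : ∫⁻ t in Ioo 0 T, ∫⁻ x, ‖u t x‖ₑ ^ (3 : ℝ) = ∫⁻ z, ‖u z.1 z.2‖ₑ ^ (3 : ℝ) ∂μT :=
      lintegral_Ioo_lintegral_eq_lintegral_prod (hum.enorm.pow_const _)
    rw [← e]
    simpa only [ENNReal.rpow_ofNat] using hu3
  have hP32 : ∫⁻ z, ‖p z.1 z.2‖ₑ ^ (3 / 2 : ℝ) ∂μT < ⊤ := by
    have e : ∫⁻ t in Ioo 0 T, ∫⁻ x, ‖p t x‖ₑ ^ (3 / 2 : ℝ) = ∫⁻ z, ‖p z.1 z.2‖ₑ ^ (3 / 2 : ℝ) ∂μT :=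
      lintegral_Ioo_lintegral_eq_lintegral_prod (hpm.enorm.pow_const _)
    rw [← e]
    exact hp
  -- the scalar fields: components `uᵢ`, `g = ⟪u, ∇ψ⟫`, weights `wᵢ = p ∂ᵢψ`
  set ui : d → ℝ → UnitAddTorus d → ℝ := fun i t x => u t x i with hui
  set g : ℝ → UnitAddTorus d → ℝ := fun t x => ⟪u t x, FunctionSpaces.Torus.gradient (ψ t) x⟫ with hg
  set w : d → ℝ × UnitAddTorus d → ℝ := fun i z =>
    p z.1 z.2 * FunctionSpaces.Torus.gradient (ψ z.1) z.2 i with hw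
  have hui_m : ∀ i, AEStronglyMeasurable (uncurry (ui i)) μT := fun i =>
    aestronglyMeasurable_uncurry_apply hum i
  have hg_m : AEStronglyMeasurable (uncurry g) μT := hum.inner hgrm
  have hgri_m : ∀ i, AEStronglyMeasurable
      (uncurry fun t x => FunctionSpaces.Torus.gradient (ψ t) x i) μT := fun i =>
    aestronglyMeasurable_uncurry_apply hgrm i
  have hw_m : ∀ i, AEStronglyMeasurable (w i) μT := fun i => hpm.mul (hgri_m i)
  have hui_3 : ∀ i, ∫⁻ z, ‖ui i z.1 z.2‖ₑ ^ (3 : ℝ) ∂μT < ⊤ := by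
    intro i
    refine lt_of_le_of_lt ?_ hU3
    refine lintegral_mono fun z => ENNReal.rpow_le_rpow ?_ (by norm_num)
    rw [← ofReal_norm, ← ofReal_norm]
    exact ENNReal.ofReal_le_ofReal (PiLp.norm_apply_le (u z.1 z.2) i)
  have hg_3 : ∫⁻ z, ‖g z.1 z.2‖ₑ ^ (3 : ℝ) ∂μT < ⊤ := by
    have hb : ∀ᵐ z ∂μT, ‖g z.1 z.2‖ ≤ C * ‖u z.1 z.2‖ := hgrb.mono fun z hz => by
      rw [hg]
      calc ‖⟪u z.1 z.2, FunctionSpaces.Torus.gradient (ψ z.1) z.2⟫‖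
          ≤ ‖u z.1 z.2‖ * ‖FunctionSpaces.Torus.gradient (ψ z.1) z.2‖ := norm_inner_le_norm _ _
        _ ≤ ‖u z.1 z.2‖ * C := mul_le_mul_of_nonneg_left hz (norm_nonneg _)
        _ = C * ‖u z.1 z.2‖ := mul_comm _ _
    refine lt_of_le_of_lt (lintegral_rpow_enorm_le_of_norm_le hC0 hb (by norm_num)) ?_
    exact ENNReal.mul_lt_top (ENNReal.rpow_lt_top_of_nonneg (by norm_num) ENNReal.ofReal_ne_top) hU3
  have hw_32 : ∀ i, ∫⁻ z, ‖w i z‖ₑ ^ (3 / 2 : ℝ) ∂μT < ⊤ := by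
    intro i
    have hb : ∀ᵐ z ∂μT, ‖w i z‖ ≤ C * ‖p z.1 z.2‖ := hgrb.mono fun z hz => by
      rw [hw, norm_mul]
      calc ‖p z.1 z.2‖ * ‖FunctionSpaces.Torus.gradient (ψ z.1) z.2 i‖
          ≤ ‖p z.1 z.2‖ * C := mul_le_mul_of_nonneg_left
            ((PiLp.norm_apply_le (FunctionSpaces.Torus.gradient (ψ z.1) z.2) i).trans hz) (norm_nonneg _)
        _ = C * ‖p z.1 z.2‖ := mul_comm _ _
    refine lt_of_le_of_lt (lintegral_rpow_enorm_le_of_norm_le hC0 hb (by norm_num)) ?_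
    exact ENNReal.mul_lt_top (ENNReal.rpow_lt_top_of_nonneg (by norm_num) ENNReal.ofReal_ne_top) hP32
  -- the mollified fields `uⱼ ⋆ M i j`, `g ⋆ ζ`: measurable and in `L³` of the product
  have h13 : (1 : ℝ) ≤ 3 := by norm_num
  have hconv_m : ∀ i j, AEStronglyMeasurable (uncurry fun t x => (ui j t ⋆ M i j) x) μT :=
    fun i j => FunctionSpaces.Torus.aestronglyMeasurable_uncurry_convolution _ (hui_m j)
      (hM i j).continuous
  have hgζ_m : AEStronglyMeasurable (uncurry fun t x => (g t ⋆ ζ) x) μT :=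
    FunctionSpaces.Torus.aestronglyMeasurable_uncurry_convolution _ hg_m hζ.continuous
  have hkfin : ∀ {k : UnitAddTorus d → ℝ}, Continuous k → (∫⁻ y, ‖k y‖ₑ) ^ (3 : ℝ) ≠ ⊤ :=
    fun hk => ENNReal.rpow_ne_top_of_nonneg (by norm_num) (hk.integrable_unitAddTorus).2.ne
  have hconv_3 : ∀ i j, ∫⁻ z, ‖(ui j z.1 ⋆ M i j) z.2‖ₑ ^ (3 : ℝ) ∂μT < ⊤ := fun i j =>
    lt_of_le_of_lt (lintegral_prod_rpow_enorm_convolution_le_mul (hui_m j) (hM i j).continuous h13)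
      (ENNReal.mul_lt_top (hkfin (hM i j).continuous).lt_top (hui_3 j))
  have hgζ_3 : ∫⁻ z, ‖(g z.1 ⋆ ζ) z.2‖ₑ ^ (3 : ℝ) ∂μT < ⊤ :=
    lt_of_le_of_lt (lintegral_prod_rpow_enorm_convolution_le_mul hg_m hζ.continuous h13)
      (ENNReal.mul_lt_top (hkfin hζ.continuous).lt_top hg_3)
  -- integrability of the products (Hölder `3/2, 3`)
  have hIA : ∀ i j, Integrable (fun z => w i z * (ui j z.1 ⋆ M i j) z.2) μT := fun i j =>
    integrable_mul_of_lintegral_rpow (hw_m i) (hconv_m i j) (hw_32 i) (hconv_3 i j)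
  have hIB : Integrable (fun z => p z.1 z.2 * (g z.1 ⋆ ζ) z.2) μT :=
    integrable_mul_of_lintegral_rpow hpm hgζ_m hP32 hgζ_3
  -- the integrands on the product space
  set F : ℝ × UnitAddTorus d → ℝ := fun z => p z.1 z.2 *
    FunctionSpaces.Torus.divergence (matSymmTestField M (ψ z.1) (u z.1)) z.2 with hF
  set A : ℝ × UnitAddTorus d → ℝ := fun z =>
    p z.1 z.2 * ⟪matConv (u z.1) M z.2, FunctionSpaces.Torus.gradient (ψ z.1) z.2⟫ with hA
  set B : ℝ × UnitAddTorus d → ℝ := fun z => p z.1 z.2 * (g z.1 ⋆ ζ) z.2 with hB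
  -- `A` is the double sum of the integrable products
  have hAsum : ∀ z, A z = ∑ i, ∑ j, w i z * (ui j z.1 ⋆ M i j) z.2 := by
    intro z
    rw [hA]
    dsimp only
    rw [PiLp.inner_apply, Finset.mul_sum]
    refine Finset.sum_congr rfl fun i _ => ?_
    rw [RCLike.inner_apply, conj_trivial, matConv_apply, Finset.mul_sum, Finset.mul_sum]
    exact Finset.sum_congr rfl fun j _ => by rw [hw, hui]; ring
  have hIA' : Integrable A μT := by
    have h : Integrable (fun z => ∑ i, ∑ j, w i z * (ui j z.1 ⋆ M i j) z.2) μT :=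
      integrable_finsetSum _ fun i _ => integrable_finsetSum _ fun j _ => hIA i j
    exact h.congr (ae_of_all _ fun z => (hAsum z).symm)
  -- a.e. slices: integrable and weakly divergence free
  have hslice1 : ∀ᵐ t ∂(volume.restrict (Ioo 0 T)), Integrable (u t) volume := by
    have h3 := FunctionSpaces.Torus.ae_memLp_of_lintegral_prod_rpow_lt_top hum (by norm_num : (0:ℝ) < 3) hU3
    filter_upwards [h3] with t ht
    exact ht.integrable (by rw [← ENNReal.ofReal_one]; exact ENNReal.ofReal_le_ofReal (by norm_num))
  have hslicep : ∀ᵐ t ∂(volume.restrict (Ioo 0 T)), Integrable (p t) volume := by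
    have h32 := FunctionSpaces.Torus.ae_memLp_of_lintegral_prod_rpow_lt_top hpm
      (by norm_num : (0:ℝ) < 3 / 2) hP32
    filter_upwards [h32] with t ht
    exact ht.integrable (by rw [← ENNReal.ofReal_one]; exact ENNReal.ofReal_le_ofReal (by norm_num))
  have hgood : ∀ᵐ z ∂μT, Integrable (u z.1) volume ∧ FunctionSpaces.Torus.IsWeaklyDivFree (u z.1) :=
    (Measure.quasiMeasurePreserving_fst (μ := volume.restrict (Ioo 0 T))
      (ν := (volume : Measure (UnitAddTorus d)))).ae (hslice1.and hdiv)
  -- the identity `F = A + B` a.e.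
  have hFAB : ∀ᵐ z ∂μT, F z = A z + B z := by
    filter_upwards [hgood] with z hz
    rw [hF, hA, hB]
    dsimp only
    rw [divergence_matSymmTestField hM hζ hpot (hψs z.1) hz.1 hz.2 z.2, mul_add]
  have hIF : Integrable F μT := (hIA'.add hIB).congr (hFAB.mono fun z hz => hz.symm)
  -- product integrals as iterated integrals
  have eF : ∫ z, F z ∂μT = ∫ t in Ioo 0 T, ∫ x,
      p t x * FunctionSpaces.Torus.divergence (matSymmTestField M (ψ t) (u t)) x :=
    integral_prod _ hIF
  have eA : ∫ z, A z ∂μT = ∫ t in Ioo 0 T, ∫ x,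
      p t x * ⟪matConv (u t) M x, FunctionSpaces.Torus.gradient (ψ t) x⟫ :=
    integral_prod _ hIA'
  have eB : ∫ z, B z ∂μT = ∫ t in Ioo 0 T, ∫ x, p t x * (g t ⋆ ζ) x := integral_prod _ hIB
  -- adjointness at a.e. time: `∫ p (g ⋆ ζ) = ∫ (p ⋆ ζ) g`
  have eB' : ∫ t in Ioo 0 T, ∫ x, p t x * (g t ⋆ ζ) x =
      ∫ t in Ioo 0 T, ∫ x, (p t ⋆ ζ) x * ⟪u t x, FunctionSpaces.Torus.gradient (ψ t) x⟫ := by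
    refine integral_congr_ae ?_
    filter_upwards [hslice1, hslicep] with t hut hpt
    have hgt : Integrable (g t) volume :=
      FunctionSpaces.Torus.integrable_inner_of_continuous hut (hψs t).gradient.continuous
    exact FunctionSpaces.Torus.integral_mul_convolution_comm hpt hgt hζ.continuous hζev
  rw [← eF, integral_congr_ae hFAB, integral_add hIA' hIB, eA, eB, eB']

end Pressure

end Literature.Analysis.FluidPDE.Torus
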